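import Summits.AtomisticToContinuum.FouriersLaw.Theses.EmbeddedDrudeMourre
import Summits.AtomisticToContinuum.FouriersLaw.Theorems.FGRGap.Negative.LoadBearing

/-!
# FGRGap, line `fold-jet-rigidity`, stub S4b (gap closing) — part D: convexity of the form from
# the branch structure

Support file for crux `EmbeddedDrudeMourre.FGRGap` (item stmt-AtomisticToContinuum-12595).
The closing argument of stub `stub_gapClosing` (parts A–B) uses CONVEXITY of
`q = boltzmannForm ω₂ a b` on `2π`-periodic measurable functions,
`q(s f + t g) ≤ s q(f) + t q(g)` (`s, t ≥ 0`, `s + t = 1`). In integrated form this needs the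
measurability of the resolved collision integrand (the lower Lebesgue integral is only
superadditive on non-measurable integrands), i.e. structural information on the resonant fibres.
Here it is derived from the TWO-ROOT STRUCTURE of the resonant set (the conclusion of the line's
structural stub GA, taken as a hypothesis, verbatim): off the diagonal of the cell
`resonantSet ω₂ k₁ k₃ = {k₃, h k₁ k₃}` with `h` jointly measurable; the exchange root `k₂ = k₃`
carries the identically vanishing bracket `f k₁ + f k₃ - f k₃ - f k₁`, so the resolved integrand is
the single measurable term `w(k₁, h, k₃) · (f k₁ + f h - f k₃ - f (k₁ + h - k₃))²`
(`finsum_resonant_eq_branch`, `boltzmannForm_eq_branch`), which is a convex function of `f`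
(pointwise convexity of the square, `w ≥ 0`).
-/

noncomputable section

open MeasureTheory Set Real Filter Topology
open scoped ENNReal
open Literature.MathematicalPhysics.KineticTheory.PhononBoltzmann
open Summit.AtomisticToContinuum.FouriersLaw.Theorems.FGRGap

namespace Summit.AtomisticToContinuum.FouriersLaw.Theorems.FGRGap.FoldJetRigidity.Closing

/-! ## The cell: off-diagonal points and `toIocMod` -/

/-- Distinct points of the cell `(-π, π]` do not differ by a multiple of `2π`. [folklore] -/
theorem forall_sub_ne_of_mem_cell {k₁ k₃ : ℝ} (hk₁ : k₁ ∈ Ioc (-π) π) (hk₃ : k₃ ∈ Ioc (-π) π)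
    (hne : k₁ ≠ k₃) : ∀ n : ℤ, k₃ - k₁ ≠ n * (2 * π) := by
  intro n hn
  have h1 : -π < k₁ := hk₁.1
  have h2 : k₁ ≤ π := hk₁.2
  have h3 : -π < k₃ := hk₃.1
  have h4 : k₃ ≤ π := hk₃.2
  have hlt : |(n : ℝ) * (2 * π)| < 2 * π := by
    rw [← hn, abs_lt]
    constructor <;> linarith
  have hn0 : n = 0 := by
    by_contra hn0
    have h1n : (1 : ℝ) ≤ |(n : ℝ)| := by
      rw [← Int.cast_abs]
      exact_mod_cast Int.one_le_abs hn0
    have : 2 * π ≤ |(n : ℝ) * (2 * π)| := by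
      rw [abs_mul, abs_of_pos (by positivity : (0 : ℝ) < 2 * π)]
      nlinarith [Real.pi_pos]
    linarith
  subst hn0
  simp only [Int.cast_zero, zero_mul, sub_eq_zero] at hn
  exact hne hn.symm

/-- `toIocMod` onto the cell fixes the points of the cell. [folklore] -/
theorem toIocMod_eq_of_mem_cell {k : ℝ} (hk : k ∈ Ioc (-π) π) :
    toIocMod Real.two_pi_pos (-π) k = k := by
  rw [toIocMod_eq_self]
  rwa [show -π + 2 * π = π by ring]

/-! ## The resolved collision integrand under the two-root structure -/

/-- **Off the diagonal the resolved energy delta is a single term.** If the resonant fibre is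
`{toIocMod k₃, h k₁ k₃}` off the diagonal, then for `k₁ ≠ k₃` in the cell
`∑ᶠ_{k₂ resonant} w (f₁ + f₂ - f₃ - f₄)² = w(k₁, h, k₃) (f k₁ + f h - f k₃ - f (k₁ + h - k₃))²`:
the exchange root `k₂ = k₃` has bracket `f k₁ + f k₃ - f k₃ - f k₁ = 0`. [folklore] -/
theorem finsum_resonant_eq_branch {ω₂ : ℝ} {h : ℝ → ℝ → ℝ}
    (hres : ∀ k₁ k₃ : ℝ, (∀ n : ℤ, k₃ - k₁ ≠ n * (2 * π)) →
      resonantSet ω₂ k₁ k₃ = {toIocMod Real.two_pi_pos (-π) k₃, h k₁ k₃})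
    (a b : ℝ) (f : ℝ → ℝ) {k₁ k₃ : ℝ} (hk₁ : k₁ ∈ Ioc (-π) π) (hk₃ : k₃ ∈ Ioc (-π) π)
    (hne : k₁ ≠ k₃) :
    (∑ᶠ k₂ ∈ resonantSet ω₂ k₁ k₃,
        collisionWeight ω₂ a b k₁ k₂ k₃ * (f k₁ + f k₂ - f k₃ - f (k₁ + k₂ - k₃)) ^ 2) =
      collisionWeight ω₂ a b k₁ (h k₁ k₃) k₃ *
        (f k₁ + f (h k₁ k₃) - f k₃ - f (k₁ + h k₁ k₃ - k₃)) ^ 2 := by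
  rw [hres k₁ k₃ (forall_sub_ne_of_mem_cell hk₁ hk₃ hne), toIocMod_eq_of_mem_cell hk₃]
  rw [finsum_mem_insert_zero (by ring), finsum_mem_singleton]

/-- Consequently the form is the double lower integral of the single branch term (the diagonal
`k₃ = k₁` is null in the inner integral). [folklore] -/
theorem boltzmannForm_eq_branch {ω₂ : ℝ} {h : ℝ → ℝ → ℝ}
    (hres : ∀ k₁ k₃ : ℝ, (∀ n : ℤ, k₃ - k₁ ≠ n * (2 * π)) →
      resonantSet ω₂ k₁ k₃ = {toIocMod Real.two_pi_pos (-π) k₃, h k₁ k₃})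
    (a b : ℝ) (f : ℝ → ℝ) :
    boltzmannForm ω₂ a b f = ENNReal.ofReal (1 / 4) *
      ∫⁻ k₁ in Ioc (-π) π, ∫⁻ k₃ in Ioc (-π) π,
        ENNReal.ofReal (collisionWeight ω₂ a b k₁ (h k₁ k₃) k₃ *
          (f k₁ + f (h k₁ k₃) - f k₃ - f (k₁ + h k₁ k₃ - k₃)) ^ 2) := by
  unfold boltzmannForm
  congr 1
  refine setLIntegral_congr_fun measurableSet_Ioc fun k₁ hk₁ => ?_
  refine lintegral_congr_ae ?_
  have hne : ∀ᵐ k₃ ∂(volume.restrict (Ioc (-π) π)), k₃ ≠ k₁ := by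
    refine ae_restrict_of_ae ?_
    rw [ae_iff]
    simp only [ne_eq, not_not, setOf_eq_eq_singleton, measure_singleton]
  filter_upwards [ae_restrict_mem measurableSet_Ioc, hne] with k₃ hk₃ hne
  rw [finsum_resonant_eq_branch hres a b f hk₁ hk₃ (Ne.symm hne)]

/-! ## Measurability of the branch term -/

/-- The collision weight is a jointly measurable function of `(k₁, k₂, k₃)`. [folklore] -/
theorem measurable_collisionWeight (ω₂ a b : ℝ) :
    Measurable (fun p : ℝ × ℝ × ℝ => collisionWeight ω₂ a b p.1 p.2.1 p.2.2) := by
  unfold collisionWeight resonanceJacobian groupVelocity vertex dispersion alsPrefactor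
  fun_prop

/-- The branch term `w(k₁, h, k₃) (f k₁ + f h - f k₃ - f (k₁ + h - k₃))²` is jointly measurable in
`(k₁, k₃)` for jointly measurable `h` and measurable `f`. [folklore] -/
theorem measurable_branchTerm (ω₂ a b : ℝ) {h : ℝ → ℝ → ℝ} (hh : Measurable (Function.uncurry h))
    {f : ℝ → ℝ} (hf : Measurable f) :
    Measurable (fun p : ℝ × ℝ => ENNReal.ofReal (collisionWeight ω₂ a b p.1 (h p.1 p.2) p.2 *
      (f p.1 + f (h p.1 p.2) - f p.2 - f (p.1 + h p.1 p.2 - p.2)) ^ 2)) := by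
  have hh' : Measurable (fun p : ℝ × ℝ => h p.1 p.2) := hh
  have e : (fun p : ℝ × ℝ => collisionWeight ω₂ a b p.1 (h p.1 p.2) p.2) =
      (fun q : ℝ × ℝ × ℝ => collisionWeight ω₂ a b q.1 q.2.1 q.2.2) ∘
        (fun p : ℝ × ℝ => (p.1, h p.1 p.2, p.2)) := rfl
  have hw : Measurable (fun p : ℝ × ℝ => collisionWeight ω₂ a b p.1 (h p.1 p.2) p.2) := by
    rw [e]
    exact (measurable_collisionWeight ω₂ a b).comp (measurable_fst.prodMk (hh'.prodMk measurable_snd))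
  have m1 : Measurable fun p : ℝ × ℝ => f p.1 := hf.comp measurable_fst
  have m2 : Measurable fun p : ℝ × ℝ => f (h p.1 p.2) := hf.comp hh'
  have m3 : Measurable fun p : ℝ × ℝ => f p.2 := hf.comp measurable_snd
  have m4 : Measurable fun p : ℝ × ℝ => f (p.1 + h p.1 p.2 - p.2) :=
    hf.comp ((measurable_fst.add hh').sub measurable_snd)
  have m5 : Measurable fun p : ℝ × ℝ =>
      (f p.1 + f (h p.1 p.2) - f p.2 - f (p.1 + h p.1 p.2 - p.2)) ^ 2 :=
    (((m1.add m2).sub m3).sub m4).pow_const 2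
  exact ENNReal.measurable_ofReal.comp (hw.mul m5)

/-- Integrating a pointwise convexity inequality twice over a set (the integrands on the right
being jointly measurable). [folklore] -/
theorem setLIntegral_setLIntegral_le_of_le {S : Set ℝ} {F G C : ℝ × ℝ → ℝ≥0∞}
    (hF : Measurable F) (hG : Measurable G) (c d : ℝ≥0∞)
    (hle : ∀ x y, C (x, y) ≤ c * F (x, y) + d * G (x, y)) :
    ∫⁻ x in S, ∫⁻ y in S, C (x, y) ≤
      c * (∫⁻ x in S, ∫⁻ y in S, F (x, y)) + d * (∫⁻ x in S, ∫⁻ y in S, G (x, y)) := by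
  have hFx : ∀ x, Measurable fun y => F (x, y) := fun x => hF.comp measurable_prodMk_left
  have hGx : ∀ x, Measurable fun y => G (x, y) := fun x => hG.comp measurable_prodMk_left
  have h1 : ∀ x, ∫⁻ y in S, C (x, y) ≤
      c * (∫⁻ y in S, F (x, y)) + d * (∫⁻ y in S, G (x, y)) := by
    intro x
    rw [← lintegral_const_mul _ (hFx x), ← lintegral_const_mul _ (hGx x),
      ← lintegral_add_left ((hFx x).const_mul c)]
    exact lintegral_mono fun y => hle x y
  calc ∫⁻ x in S, ∫⁻ y in S, C (x, y)
      ≤ ∫⁻ x in S, (c * (∫⁻ y in S, F (x, y)) + d * (∫⁻ y in S, G (x, y))) := lintegral_mono h1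
    _ = c * (∫⁻ x in S, ∫⁻ y in S, F (x, y)) + d * (∫⁻ x in S, ∫⁻ y in S, G (x, y)) := by
      rw [lintegral_add_left (hF.lintegral_prod_right'.const_mul c),
        lintegral_const_mul _ hF.lintegral_prod_right',
        lintegral_const_mul _ hG.lintegral_prod_right']

/-! ## Pointwise convexity of the branch term -/

/-- `(s x + t y)² ≤ s x² + t y²` for `s, t ≥ 0`, `s + t = 1`. [folklore] -/
theorem sq_convex_comb_le {s t : ℝ} (hs : 0 ≤ s) (ht : 0 ≤ t) (hst : s + t = 1) (x y : ℝ) :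
    (s * x + t * y) ^ 2 ≤ s * x ^ 2 + t * y ^ 2 := by
  have ht' : t = 1 - s := by linarith
  subst ht'
  nlinarith [mul_nonneg (mul_nonneg hs ht) (sq_nonneg (x - y))]

/-- Pointwise convexity of the branch term in `f` (the bracket is linear in `f`, the weight is
non-negative), in `ℝ≥0∞`. [folklore] -/
theorem ofReal_branchTerm_convex (ω₂ a b : ℝ) (f g : ℝ → ℝ) {s t : ℝ} (hs : 0 ≤ s) (ht : 0 ≤ t)
    (hst : s + t = 1) (k₁ k₂ k₃ : ℝ) :
    ENNReal.ofReal (collisionWeight ω₂ a b k₁ k₂ k₃ *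
        ((s * f k₁ + t * g k₁) + (s * f k₂ + t * g k₂) - (s * f k₃ + t * g k₃) -
          (s * f (k₁ + k₂ - k₃) + t * g (k₁ + k₂ - k₃))) ^ 2) ≤
      ENNReal.ofReal s *
          ENNReal.ofReal (collisionWeight ω₂ a b k₁ k₂ k₃ *
            (f k₁ + f k₂ - f k₃ - f (k₁ + k₂ - k₃)) ^ 2) +
        ENNReal.ofReal t *
          ENNReal.ofReal (collisionWeight ω₂ a b k₁ k₂ k₃ *
            (g k₁ + g k₂ - g k₃ - g (k₁ + k₂ - k₃)) ^ 2) := by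
  have hw := collisionWeight_nonneg ω₂ a b k₁ k₂ k₃
  set w := collisionWeight ω₂ a b k₁ k₂ k₃
  set x := f k₁ + f k₂ - f k₃ - f (k₁ + k₂ - k₃)
  set y := g k₁ + g k₂ - g k₃ - g (k₁ + k₂ - k₃)
  have hlin : (s * f k₁ + t * g k₁) + (s * f k₂ + t * g k₂) - (s * f k₃ + t * g k₃) -
      (s * f (k₁ + k₂ - k₃) + t * g (k₁ + k₂ - k₃)) = s * x + t * y := by
    simp only [x, y]
    ring
  rw [hlin, ← ENNReal.ofReal_mul hs, ← ENNReal.ofReal_mul ht,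
    ← ENNReal.ofReal_add (by positivity) (by positivity)]
  apply ENNReal.ofReal_le_ofReal
  calc w * (s * x + t * y) ^ 2 ≤ w * (s * x ^ 2 + t * y ^ 2) :=
        mul_le_mul_of_nonneg_left (sq_convex_comb_le hs ht hst x y) hw
    _ = s * (w * x ^ 2) + t * (w * y ^ 2) := by ring

/-! ## Convexity of the form -/

/-- **Convexity of the Boltzmann form from the two-root structure of the resonant set.** If off
the diagonal of the cell the resonant fibre is `{k₃ mod 2π, h k₁ k₃}` with `h` jointly measurable,
then `q(s f + t g) ≤ s q(f) + t q(g)` for measurable `f, g` and `s, t ≥ 0`, `s + t = 1`.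
[folklore] -/
theorem boltzmannForm_convex_of_twoRoot {ω₂ : ℝ} {h : ℝ → ℝ → ℝ}
    (hres : ∀ k₁ k₃ : ℝ, (∀ n : ℤ, k₃ - k₁ ≠ n * (2 * π)) →
      resonantSet ω₂ k₁ k₃ = {toIocMod Real.two_pi_pos (-π) k₃, h k₁ k₃})
    (hh : Measurable (Function.uncurry h)) (a b : ℝ) {f g : ℝ → ℝ} (hf : Measurable f)
    (hg : Measurable g) {s t : ℝ} (hs : 0 ≤ s) (ht : 0 ≤ t) (hst : s + t = 1) :
    boltzmannForm ω₂ a b (fun k => s * f k + t * g k) ≤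
      ENNReal.ofReal s * boltzmannForm ω₂ a b f + ENNReal.ofReal t * boltzmannForm ω₂ a b g := by
  have key : ∫⁻ k₁ in Ioc (-π) π, ∫⁻ k₃ in Ioc (-π) π,
      ENNReal.ofReal (collisionWeight ω₂ a b k₁ (h k₁ k₃) k₃ *
        ((s * f k₁ + t * g k₁) + (s * f (h k₁ k₃) + t * g (h k₁ k₃)) - (s * f k₃ + t * g k₃) -
          (s * f (k₁ + h k₁ k₃ - k₃) + t * g (k₁ + h k₁ k₃ - k₃))) ^ 2) ≤
      ENNReal.ofReal s * (∫⁻ k₁ in Ioc (-π) π, ∫⁻ k₃ in Ioc (-π) π,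
          ENNReal.ofReal (collisionWeight ω₂ a b k₁ (h k₁ k₃) k₃ *
            (f k₁ + f (h k₁ k₃) - f k₃ - f (k₁ + h k₁ k₃ - k₃)) ^ 2)) +
        ENNReal.ofReal t * (∫⁻ k₁ in Ioc (-π) π, ∫⁻ k₃ in Ioc (-π) π,
          ENNReal.ofReal (collisionWeight ω₂ a b k₁ (h k₁ k₃) k₃ *
            (g k₁ + g (h k₁ k₃) - g k₃ - g (k₁ + h k₁ k₃ - k₃)) ^ 2)) :=
    setLIntegral_setLIntegral_le_of_le
      (C := fun p : ℝ × ℝ => ENNReal.ofReal (collisionWeight ω₂ a b p.1 (h p.1 p.2) p.2 *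
        ((s * f p.1 + t * g p.1) + (s * f (h p.1 p.2) + t * g (h p.1 p.2)) -
          (s * f p.2 + t * g p.2) -
          (s * f (p.1 + h p.1 p.2 - p.2) + t * g (p.1 + h p.1 p.2 - p.2))) ^ 2))
      (measurable_branchTerm ω₂ a b hh hf) (measurable_branchTerm ω₂ a b hh hg) _ _
      fun k₁ k₃ => ofReal_branchTerm_convex ω₂ a b f g hs ht hst k₁ (h k₁ k₃) k₃
  rw [boltzmannForm_eq_branch hres a b (fun k => s * f k + t * g k),
    boltzmannForm_eq_branch hres a b f, boltzmannForm_eq_branch hres a b g]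
  calc ENNReal.ofReal (1 / 4) * ∫⁻ k₁ in Ioc (-π) π, ∫⁻ k₃ in Ioc (-π) π,
        ENNReal.ofReal (collisionWeight ω₂ a b k₁ (h k₁ k₃) k₃ *
          ((s * f k₁ + t * g k₁) + (s * f (h k₁ k₃) + t * g (h k₁ k₃)) - (s * f k₃ + t * g k₃) -
            (s * f (k₁ + h k₁ k₃ - k₃) + t * g (k₁ + h k₁ k₃ - k₃))) ^ 2)
      ≤ ENNReal.ofReal (1 / 4) * (ENNReal.ofReal s * (∫⁻ k₁ in Ioc (-π) π, ∫⁻ k₃ in Ioc (-π) π,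
            ENNReal.ofReal (collisionWeight ω₂ a b k₁ (h k₁ k₃) k₃ *
              (f k₁ + f (h k₁ k₃) - f k₃ - f (k₁ + h k₁ k₃ - k₃)) ^ 2)) +
          ENNReal.ofReal t * (∫⁻ k₁ in Ioc (-π) π, ∫⁻ k₃ in Ioc (-π) π,
            ENNReal.ofReal (collisionWeight ω₂ a b k₁ (h k₁ k₃) k₃ *
              (g k₁ + g (h k₁ k₃) - g k₃ - g (k₁ + h k₁ k₃ - k₃)) ^ 2))) := by
        gcongr
    _ = _ := by ring

/-- **Convexity of the form from the branch structure (GA bundle, verbatim).** Only the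
off-diagonal two-root description of the resonant fibre and the joint measurability of the partner
map `h` are used; periodicity of `f, g` is not needed. [folklore] -/
theorem boltzmannForm_convex_of_branch :
    ∀ ω₂ : ℝ, ∀ h : ℝ → ℝ → ℝ,
      ((∀ k₁ k₃ : ℝ, h k₁ k₃ ∈ Set.Ioc (-π) π) ∧
        (∀ k₁ k₃ : ℝ, resonanceFn ω₂ k₁ (h k₁ k₃) k₃ = 0) ∧
        (∀ k₁ k₃ : ℝ, h (k₁ + 2 * π) k₃ = h k₁ k₃ ∧ h k₁ (k₃ + 2 * π) = h k₁ k₃) ∧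
        (∀ k : ℝ, k ∈ Set.Ioc (-π) π → h k k = k) ∧
        (∀ k₁ k₃ : ℝ, (∀ n : ℤ, k₃ - k₁ ≠ n * (2 * π)) →
          resonantSet ω₂ k₁ k₃ = {toIocMod Real.two_pi_pos (-π) k₃, h k₁ k₃}) ∧
        (∀ k₁ k₃ : ℝ, (∀ n : ℤ, k₃ - k₁ ≠ n * (2 * π)) →
          (h k₁ k₃ = toIocMod Real.two_pi_pos (-π) k₃ ↔ groupVelocity ω₂ k₃ = groupVelocity ω₂ k₁)) ∧
        (∀ k₁ k₃ : ℝ, groupVelocity ω₂ k₃ ≠ groupVelocity ω₂ k₁ →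
          groupVelocity ω₂ (h k₁ k₃) ≠ groupVelocity ω₂ (k₁ + h k₁ k₃ - k₃)) ∧
        Measurable (Function.uncurry h) ∧
        (∀ k₁ k₃ : ℝ, groupVelocity ω₂ k₃ ≠ groupVelocity ω₂ k₁ →
          ∃ (φ : ℝ × ℝ → ℝ) (U : Set (ℝ × ℝ)), U ∈ 𝓝 (k₁, k₃) ∧ AnalyticOnNhd ℝ φ U ∧
            φ (k₁, k₃) = h k₁ k₃ ∧ (∀ p ∈ U, ∃ n : ℤ, φ p = h p.1 p.2 + n * (2 * π)) ∧
            (∀ p ∈ U, groupVelocity ω₂ p.2 ≠ groupVelocity ω₂ p.1) ∧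
            (∀ p ∈ U, HasStrictFDerivAt φ (((groupVelocity ω₂ (p.1 + φ p - p.2) - groupVelocity ω₂ p.1) /
              (groupVelocity ω₂ (φ p) - groupVelocity ω₂ (p.1 + φ p - p.2))) • ContinuousLinearMap.fst ℝ ℝ ℝ +
            ((groupVelocity ω₂ p.2 - groupVelocity ω₂ (p.1 + φ p - p.2)) /
              (groupVelocity ω₂ (φ p) - groupVelocity ω₂ (p.1 + φ p - p.2))) • ContinuousLinearMap.snd ℝ ℝ ℝ) p))) →
      ∀ a b : ℝ,
        (∀ (f g : ℝ → ℝ) (s t : ℝ), Function.Periodic f (2 * π) → Measurable f →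
          Function.Periodic g (2 * π) → Measurable g → 0 ≤ s → 0 ≤ t → s + t = 1 →
          boltzmannForm ω₂ a b (fun k => s * f k + t * g k) ≤
            ENNReal.ofReal s * boltzmannForm ω₂ a b f + ENNReal.ofReal t * boltzmannForm ω₂ a b g) := by
  intro ω₂ h hB a b f g s t _ hf _ hg hs ht hst
  exact boltzmannForm_convex_of_twoRoot hB.2.2.2.2.1 hB.2.2.2.2.2.2.2.1 a b hf hg hs ht hst

end Summit.AtomisticToContinuum.FouriersLaw.Theorems.FGRGap.FoldJetRigidity.Closing

namespace Summit.AtomisticToContinuum.FouriersLaw.Theorems.FGRGap.FoldJetRigidity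

/-- Helper stub D of `stub_gapClosing` (line fold-jet-rigidity): the branch structure (GA) gives
the convexity of the Boltzmann form on periodic measurable functions. [folklore] -/
theorem stub_gapClosing_partD :
    ∀ ω₂ : ℝ, ∀ h : ℝ → ℝ → ℝ,
      ((∀ k₁ k₃ : ℝ, h k₁ k₃ ∈ Set.Ioc (-π) π) ∧
        (∀ k₁ k₃ : ℝ, resonanceFn ω₂ k₁ (h k₁ k₃) k₃ = 0) ∧
        (∀ k₁ k₃ : ℝ, h (k₁ + 2 * π) k₃ = h k₁ k₃ ∧ h k₁ (k₃ + 2 * π) = h k₁ k₃) ∧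
        (∀ k : ℝ, k ∈ Set.Ioc (-π) π → h k k = k) ∧
        (∀ k₁ k₃ : ℝ, (∀ n : ℤ, k₃ - k₁ ≠ n * (2 * π)) →
          resonantSet ω₂ k₁ k₃ = {toIocMod Real.two_pi_pos (-π) k₃, h k₁ k₃}) ∧
        (∀ k₁ k₃ : ℝ, (∀ n : ℤ, k₃ - k₁ ≠ n * (2 * π)) →
          (h k₁ k₃ = toIocMod Real.two_pi_pos (-π) k₃ ↔ groupVelocity ω₂ k₃ = groupVelocity ω₂ k₁)) ∧
        (∀ k₁ k₃ : ℝ, groupVelocity ω₂ k₃ ≠ groupVelocity ω₂ k₁ →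
          groupVelocity ω₂ (h k₁ k₃) ≠ groupVelocity ω₂ (k₁ + h k₁ k₃ - k₃)) ∧
        Measurable (Function.uncurry h) ∧
        (∀ k₁ k₃ : ℝ, groupVelocity ω₂ k₃ ≠ groupVelocity ω₂ k₁ →
          ∃ (φ : ℝ × ℝ → ℝ) (U : Set (ℝ × ℝ)), U ∈ 𝓝 (k₁, k₃) ∧ AnalyticOnNhd ℝ φ U ∧
            φ (k₁, k₃) = h k₁ k₃ ∧ (∀ p ∈ U, ∃ n : ℤ, φ p = h p.1 p.2 + n * (2 * π)) ∧
            (∀ p ∈ U, groupVelocity ω₂ p.2 ≠ groupVelocity ω₂ p.1) ∧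
            (∀ p ∈ U, HasStrictFDerivAt φ (((groupVelocity ω₂ (p.1 + φ p - p.2) - groupVelocity ω₂ p.1) /
              (groupVelocity ω₂ (φ p) - groupVelocity ω₂ (p.1 + φ p - p.2))) • ContinuousLinearMap.fst ℝ ℝ ℝ +
            ((groupVelocity ω₂ p.2 - groupVelocity ω₂ (p.1 + φ p - p.2)) /
              (groupVelocity ω₂ (φ p) - groupVelocity ω₂ (p.1 + φ p - p.2))) • ContinuousLinearMap.snd ℝ ℝ ℝ) p))) →
      ∀ a b : ℝ,
        (∀ (f g : ℝ → ℝ) (s t : ℝ), Function.Periodic f (2 * π) → Measurable f → Function.Periodic g (2 * π) →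
          Measurable g → 0 ≤ s → 0 ≤ t → s + t = 1 →
          boltzmannForm ω₂ a b (fun k => s * f k + t * g k) ≤
            ENNReal.ofReal s * boltzmannForm ω₂ a b f + ENNReal.ofReal t * boltzmannForm ω₂ a b g) :=
  Closing.boltzmannForm_convex_of_branch

end Summit.AtomisticToContinuum.FouriersLaw.Theorems.FGRGap.FoldJetRigidity

end
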